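import Summits.CriticalPhenomena.PercolationContinuityZ3.Theorems.PercNearOneGluingNoHeavyQuantThreeClusterFibre
import HarnessLib

/-!
# The rooted fibre injection, counting form; the depth-0 count `TN₀ ≤ E` in every class

builds on p205010 (kernel theorem, internal audit signed; external expert review pending)

Support file (`--supports stmt-CriticalPhenomena-4575`), seat `prim-quant-p1` (gen 43); memo
`run/shared/lean/prim/quant/prim-quant-p1-g43/FOR-LEAD-Z32-FIBRES.md` §2.  No definitions, no named facts, no sorries;
standard axioms.

The per-class ("coefficientwise", ✓ p583525) form of the rooted fibre map of the companion file
`…QuantThreeClusterFibre` (`Z := C₁` on `T(A) ∪ J`, `C₂` elsewhere; `A` a root region, `J` the doors from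
`N = {a} ∪ A ∪ N_{C₁}(A)` into `C_b(C₂)`):
* `classCount_fibre_le` — in a class `I ⊆ U` (free edges `F`, `C₁ = I ∪ T`, `C₂ = I ∪ (F ∖ T)`), for every FIXED root
  region `A`: the number of `T` with `b ↮ c` in `C₂`, `N` missing the `C₂`-clusters of `b` and `c`, `A` reachable from `a`
  inside `T(A)`, and at least one door, is at most `#{T : I ∪ T ∈ ab|c}` (injectivity by `fibre_decode_N/S/J`, the image
  by `fibre_reachable_b` / `fibre_not_reachable_c`);
* `classCount_depthZero_le` — the case `A = ∅`: `C₂` pairwise separated at `a, b, c` and a `C₁`-open edge `s(a, s)` with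
  `s ∈ C_b(C₂)`; the image is `C₂` with the doors at `a` opened;
* `classCount_TN_depthZero_le_E` — **the depth-0 part of `TN` is at most `E` in every class**: `#{T : C₂ ∈ a|b|c, a joined
  by a C₁-edge to C_b(C₂) ∪ C_c(C₂)} ≤ #{T : C₁ ∈ ab|c ∪ ac|b}` (the "fibre-at-a count" of the p1 g42 memo §4.3/§7, which
  covers all 2 636 residual configurations `R₀_bad` on 8 vertices, kit j301407).  With `A` = the `C₁`-ball of radius `d-1`
  the same theorem is the per-fibre capacity count of the multi-depth fibre system (memo §2; the ball is read off the image,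
  so one depth injects; different depths share at most one partner per pair of fibres).
-/

namespace Summit.CriticalPhenomena.PercolationContinuityZ3.Theorems

open Finset Literature.Probability.Percolation Literature.Probability.Percolation.DecisionTree

variable {V : Type*}

namespace ThreeClusterSwap

/-! ### Counting form: the rooted fibre map as an injection of one class into `ab|c` -/

section Count

variable [Fintype V] [DecidableEq V]

open scoped Classical

/-- **Rooted fibre injection, counting form.**  In a class with forced-open edges `I` and free edges `F`
(`C₁ = I ∪ T`, `C₂ = I ∪ (F ∖ T)`, `T ⊆ F`), fix a root region `A`.  With `N_T = {a} ∪ A ∪ N_{C₁}(A)`: the number of `T`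
such that `b ↮ c` in `C₂`, no vertex of `N_T` is `C₂`-joined to `b` or to `c`, every vertex of `A` is `C₁`-reachable from
`a` through edges touching `A`, and some `C₁`-open edge joins `N_T` to `C_b(C₂)`, is at most the number of `T` with
`I ∪ T ∈ ab|c`.  The map takes `C₁`-values on `W = T(A) ∪ J` (`J` the doors) and `C₂`-values elsewhere; it is decoded by
`fibre_decode_N/S/J`. [this work] -/
theorem classCount_fibre_le (I F : Finset (Sym2 V)) (A : Finset V) (a b c : V) :
    ((F.powerset.filter fun T =>
        ¬ (openGraph (↑(I ∪ (F \ T)) : Set (Sym2 V))).Reachable b c ∧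
        (∀ v ∈ ({v | v = a ∨ v ∈ (↑A : Set V) ∨ ∃ u ∈ (↑A : Set V), s(u, v) ∈ (↑(I ∪ T) : Set (Sym2 V)) ∧ u ≠ v} : Set V),
          ¬ (openGraph (↑(I ∪ (F \ T)) : Set (Sym2 V))).Reachable b v ∧
          ¬ (openGraph (↑(I ∪ (F \ T)) : Set (Sym2 V))).Reachable c v) ∧
        (∀ v ∈ (↑A : Set V), (openGraph ((↑(I ∪ T) : Set (Sym2 V)) ∩ {e | ∃ v ∈ (↑A : Set V), v ∈ e})).Reachable a v) ∧
        (∃ e ∈ (↑(I ∪ T) : Set (Sym2 V)),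
          ∃ u ∈ ({v | v = a ∨ v ∈ (↑A : Set V) ∨ ∃ u ∈ (↑A : Set V), s(u, v) ∈ (↑(I ∪ T) : Set (Sym2 V)) ∧ u ≠ v} : Set V),
          ∃ s ∈ ({v | (openGraph (↑(I ∪ (F \ T)) : Set (Sym2 V))).Reachable b v} : Set V), e = s(u, s))).card) ≤
    (F.powerset.filter fun T =>
        (openGraph (↑(I ∪ T) : Set (Sym2 V))).Reachable a b ∧
          ¬ (openGraph (↑(I ∪ T) : Set (Sym2 V))).Reachable a c).card := by
  -- the data of the map, as functions of `T`
  let X : Finset (Sym2 V) → Set (Sym2 V) := fun T => (↑(I ∪ T) : Set (Sym2 V))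
  let Xb : Finset (Sym2 V) → Set (Sym2 V) := fun T => (↑(I ∪ (F \ T)) : Set (Sym2 V))
  let As : Set V := (↑A : Set V)
  let N : Finset (Sym2 V) → Set V := fun T => {v | v = a ∨ v ∈ As ∨ ∃ u ∈ As, s(u, v) ∈ X T ∧ u ≠ v}
  let S : Finset (Sym2 V) → Set V := fun T => {v | (openGraph (Xb T)).Reachable b v}
  let TA : Set (Sym2 V) := {e | ∃ v ∈ As, v ∈ e}
  let J : Finset (Sym2 V) → Set (Sym2 V) := fun T => {e | e ∈ X T ∧ ∃ u ∈ N T, ∃ s ∈ S T, e = s(u, s)}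
  let W : Finset (Sym2 V) → Set (Sym2 V) := fun T => TA ∪ J T
  let G : Finset (Sym2 V) → Finset (Sym2 V) := fun T => F.filter fun e => e ∈ (W T)ᶜ
  let f : Finset (Sym2 V) → Finset (Sym2 V) := fun T => (T \ G T) ∪ ((F \ T) ∩ G T)
  have hG : ∀ T e, e ∈ G T ↔ e ∈ F ∧ e ∈ (W T)ᶜ := fun T e => Finset.mem_filter
  -- the image is the mixture `Z = C₁ on W, C₂ elsewhere`
  have hcoe : ∀ T ⊆ F, (↑(I ∪ f T) : Set (Sym2 V)) = (X T ∩ W T) ∪ (Xb T \ W T) := by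
    intro T hT
    rw [coe_union_flipOn I F T (G T) (W T)ᶜ hT (hG T)]
    ext e
    simp only [Set.mem_union, Set.mem_inter_iff, Set.mem_sdiff, Set.mem_compl_iff, X, Xb]
    tauto
  refine Finset.card_le_card_of_injOn f (fun T hT => ?_) (fun T₁ h₁ T₂ h₂ heq => ?_)
  · rw [Finset.mem_coe, Finset.mem_filter, Finset.mem_powerset] at hT ⊢
    obtain ⟨hTF, hbc, hNsep, hconn, hJne⟩ := hT
    have hNS : ∀ v ∈ N T, v ∉ S T := fun v hv hvS => (hNsep v hv).1 hvS
    have hNSc : ∀ v ∈ N T, ¬ (openGraph (Xb T)).Reachable c v := fun v hv => (hNsep v hv).2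
    have hJne' : ∃ e, e ∈ J T := by
      obtain ⟨e, he, u, hu, s, hs, rfl⟩ := hJne
      exact ⟨s(u, s), he, u, hu, s, hs, rfl⟩
    refine ⟨flipOn_subset F (G T) T hTF, ?_, ?_⟩
    · rw [hcoe T hTF]
      exact fibre_reachable_b (X T) (Xb T) a b As (N T) (S T) TA (J T) (W T) _ rfl rfl rfl rfl rfl rfl hconn hNS hJne'
    · rw [hcoe T hTF]
      exact fibre_not_reachable_c (X T) (Xb T) a b c As (N T) (S T) TA (J T) (W T) _ rfl rfl rfl rfl rfl rfl hNSc hbc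
  · rw [Finset.coe_filter] at h₁ h₂
    have hT₁ : T₁ ⊆ F := Finset.mem_powerset.1 h₁.1
    have hT₂ : T₂ ⊆ F := Finset.mem_powerset.1 h₂.1
    have hNS₁ : ∀ v ∈ N T₁, v ∉ S T₁ := fun v hv hvS => (h₁.2.2.1 v hv).1 hvS
    have hNS₂ : ∀ v ∈ N T₂, v ∉ S T₂ := fun v hv hvS => (h₂.2.2.1 v hv).1 hvS
    -- the common image
    have hZeq : (X T₁ ∩ W T₁) ∪ (Xb T₁ \ W T₁) = (X T₂ ∩ W T₂) ∪ (Xb T₂ \ W T₂) := by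
      rw [← hcoe T₁ hT₁, ← hcoe T₂ hT₂, heq]
    -- decode `N`, then `S`, then `J`, hence `W`
    have hNeq : N T₁ = N T₂ := by
      rw [← fibre_decode_N (X T₁) (Xb T₁) a As (N T₁) TA (J T₁) (W T₁) _ rfl rfl rfl rfl,
        ← fibre_decode_N (X T₂) (Xb T₂) a As (N T₂) TA (J T₂) (W T₂) _ rfl rfl rfl rfl, hZeq]
    have hSeq : S T₁ = S T₂ := by
      ext v
      change (openGraph (Xb T₁)).Reachable b v ↔ (openGraph (Xb T₂)).Reachable b v
      rw [← fibre_decode_S (X T₁) (Xb T₁) a b As (N T₁) (S T₁) TA (J T₁) (W T₁) _ rfl rfl rfl rfl rfl rfl hNS₁ v,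
        ← fibre_decode_S (X T₂) (Xb T₂) a b As (N T₂) (S T₂) TA (J T₂) (W T₂) _ rfl rfl rfl rfl rfl rfl hNS₂ v,
        hZeq, hNeq]
    have hJeq : J T₁ = J T₂ := by
      rw [← fibre_decode_J (X T₁) (Xb T₁) b (N T₁) (S T₁) TA (J T₁) (W T₁) _ rfl rfl rfl rfl hNS₁,
        ← fibre_decode_J (X T₂) (Xb T₂) b (N T₂) (S T₂) TA (J T₂) (W T₂) _ rfl rfl rfl rfl hNS₂, hZeq, hNeq, hSeq]
    have hWeq : W T₁ = W T₂ := by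
      change TA ∪ J T₁ = TA ∪ J T₂
      rw [hJeq]
    have hGeq : G T₁ = G T₂ := by
      ext e
      rw [hG, hG, hWeq]
    have e1 : T₁ = ((f T₁ \ G T₁) ∪ ((F \ f T₁) ∩ G T₁)) := (flipOn_flipOn F (G T₁) T₁ hT₁).symm
    have e2 : T₂ = ((f T₂ \ G T₂) ∪ ((F \ f T₂) ∩ G T₂)) := (flipOn_flipOn F (G T₂) T₂ hT₂).symm
    rw [e1, e2, heq, hGeq]

/-- **Depth 0 towards `b`** (`A = ∅`): in every class, the number of `T` with `a, b, c` pairwise separated in `C₂` and some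
`C₁`-open edge at `a` entering `C_b(C₂)` is at most `#{T : I ∪ T ∈ ab|c}` — the image is `C₂` with those doors opened.
[this work] -/
theorem classCount_depthZero_le (I F : Finset (Sym2 V)) (a b c : V) :
    ((F.powerset.filter fun T =>
        ¬ (openGraph (↑(I ∪ (F \ T)) : Set (Sym2 V))).Reachable b c ∧
        ¬ (openGraph (↑(I ∪ (F \ T)) : Set (Sym2 V))).Reachable b a ∧
        ¬ (openGraph (↑(I ∪ (F \ T)) : Set (Sym2 V))).Reachable c a ∧
        (∃ s, (openGraph (↑(I ∪ (F \ T)) : Set (Sym2 V))).Reachable b s ∧ s(a, s) ∈ (↑(I ∪ T) : Set (Sym2 V)))).card) ≤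
    (F.powerset.filter fun T =>
        (openGraph (↑(I ∪ T) : Set (Sym2 V))).Reachable a b ∧
          ¬ (openGraph (↑(I ∪ T) : Set (Sym2 V))).Reachable a c).card := by
  refine le_trans (Finset.card_le_card fun T hT => ?_) (classCount_fibre_le I F (∅ : Finset V) a b c)
  rw [Finset.mem_filter] at hT ⊢
  obtain ⟨hTF, hbc, hba, hca, s, hbs, has⟩ := hT
  have hN : ∀ v, v ∈ ({v | v = a ∨ v ∈ (↑(∅ : Finset V) : Set V) ∨
      ∃ u ∈ (↑(∅ : Finset V) : Set V), s(u, v) ∈ (↑(I ∪ T) : Set (Sym2 V)) ∧ u ≠ v} : Set V) → v = a := by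
    intro v hv
    rcases hv with h | h | ⟨u, hu, -⟩
    · exact h
    · simp at h
    · simp at hu
  refine ⟨hTF, hbc, fun v hv => ?_, fun v hv => by simp at hv, ⟨s(a, s), has, a, Or.inl rfl, s, hbs, rfl⟩⟩
  rw [hN v hv]
  exact ⟨hba, hca⟩

/-- Bookkeeping: if `p ⊆ p₁ ∪ p₂` on `s`, `#p₁ ≤ #q_b`, `#p₂ ≤ #q_a` and `q_a, q_b` are disjoint then `#p ≤ #(q_a ∨ q_b)`.
[this work] -/
theorem card_filter_le_of_cover_two {β : Type*} {s : Finset β} {p p₁ p₂ qa qb : β → Prop}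
    {d : DecidablePred p} {d₁ : DecidablePred p₁} {d₂ : DecidablePred p₂}
    {da : DecidablePred qa} {db : DecidablePred qb} {dab : DecidablePred fun x => qa x ∨ qb x}
    (h₁ : (@Finset.filter β p₁ d₁ s).card ≤ (@Finset.filter β qb db s).card)
    (h₂ : (@Finset.filter β p₂ d₂ s).card ≤ (@Finset.filter β qa da s).card)
    (hdisj : ∀ x, qa x → qb x → False)
    (hcover : ∀ x ∈ s, p x → p₁ x ∨ p₂ x) :
    (@Finset.filter β p d s).card ≤ (@Finset.filter β (fun x => qa x ∨ qb x) dab s).card := by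
  have hcov : @Finset.filter β p d s ⊆ @Finset.filter β p₁ d₁ s ∪ @Finset.filter β p₂ d₂ s := by
    intro x hx
    rw [Finset.mem_filter] at hx
    simp only [Finset.mem_union, Finset.mem_filter]
    rcases hcover x hx.1 hx.2 with h | h
    · exact Or.inl ⟨hx.1, h⟩
    · exact Or.inr ⟨hx.1, h⟩
  have hE : (@Finset.filter β qa da s).card + (@Finset.filter β qb db s).card ≤
      (@Finset.filter β (fun x => qa x ∨ qb x) dab s).card := by
    rw [← Finset.card_union_of_disjoint]
    · refine Finset.card_le_card fun x hx => ?_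
      rw [Finset.mem_union, Finset.mem_filter, Finset.mem_filter] at hx
      rw [Finset.mem_filter]
      rcases hx with ⟨h1, h2⟩ | ⟨h1, h2⟩
      · exact ⟨h1, Or.inl h2⟩
      · exact ⟨h1, Or.inr h2⟩
    · rw [Finset.disjoint_left]
      intro x hx1 hx2
      rw [Finset.mem_filter] at hx1 hx2
      exact hdisj x hx1.2 hx2.2
  have h0 := (Finset.card_le_card hcov).trans (Finset.card_union_le _ _)
  omega

/-- **The depth-0 part of `TN` is at most `E`, in every class** (the "fibre-at-a count" of the p1 g42 memo, §4.3/§7):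
the number of `T` with `C₂ = I ∪ (F ∖ T) ∈ a|b|c` (pairwise separated) and the vertex `a` joined by a `C₁ = I ∪ T`-open
edge to the `C₂`-cluster of `b` or of `c` is at most the number of `T` with `I ∪ T ∈ ab|c ∪ ac|b`.  (No use is made of
`C₁ ∈ abc`.)  [this work] -/
theorem classCount_TN_depthZero_le_E (I F : Finset (Sym2 V)) (a b c : V) :
    ((F.powerset.filter fun T =>
        (¬ (openGraph (↑(I ∪ (F \ T)) : Set (Sym2 V))).Reachable a b ∧
          ¬ (openGraph (↑(I ∪ (F \ T)) : Set (Sym2 V))).Reachable a c ∧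
          ¬ (openGraph (↑(I ∪ (F \ T)) : Set (Sym2 V))).Reachable b c) ∧
        (∃ s, ((openGraph (↑(I ∪ (F \ T)) : Set (Sym2 V))).Reachable b s ∨
            (openGraph (↑(I ∪ (F \ T)) : Set (Sym2 V))).Reachable c s) ∧
          s(a, s) ∈ (↑(I ∪ T) : Set (Sym2 V)))).card) ≤
    (F.powerset.filter fun T =>
        ((openGraph (↑(I ∪ T) : Set (Sym2 V))).Reachable a b ∧
            ¬ (openGraph (↑(I ∪ T) : Set (Sym2 V))).Reachable a c) ∨
          ((openGraph (↑(I ∪ T) : Set (Sym2 V))).Reachable a c ∧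
            ¬ (openGraph (↑(I ∪ T) : Set (Sym2 V))).Reachable a b)).card := by
  have hb := classCount_depthZero_le I F a b c
  have hc := classCount_depthZero_le I F a c b
  refine card_filter_le_of_cover_two hc hb (fun T h1 h2 => h1.2 h2.1) fun T _ hT => ?_
  obtain ⟨⟨hab, hac, hbc⟩, s, hs, has⟩ := hT
  rcases hs with hs | hs
  · exact Or.inr ⟨hbc, fun h => hab h.symm, fun h => hac h.symm, s, hs, has⟩
  · exact Or.inl ⟨fun h => hbc h.symm, fun h => hac h.symm, fun h => hab h.symm, s, hs, has⟩

end Count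

end ThreeClusterSwap

end Summit.CriticalPhenomena.PercolationContinuityZ3.Theorems
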